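import Literature.AlgebraicGeometry.Resolution.RegularWeakTransformPrime
import Literature.AlgebraicGeometry.Resolution.RegularCentreRsopPartNested
import Literature.AlgebraicGeometry.Resolution.SubschemeRegularStalks
import Literature.AlgebraicGeometry.Resolution.MarkedIdealsArithmetic
import Literature.AlgebraicGeometry.Resolution.RetractionBlowupTransform
import Literature.AlgebraicGeometry.Resolution.HypersurfaceRestrictionTransform
import HarnessLib

/-!
# Crux `PatchingRelPerfect` (stmt-ResolutionOfSingularities-16161), chain W5.2 — R4ˢ support, part 1:
# separation of strict transforms and the regular trace of a strict transform on the exceptional divisor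

[OURS · L1 W5.2 · rung tool] Fact-free, any dimension / characteristic; nothing here is a statement of the
manuscript under review. Tools for the X-side END-GAME of the depth-two rung (part 2,
`…DepthTwoEndGame.lean`: res-L1-w52-lead-1 LIT NOTE §4 «two further blow-ups along `V(u, f̂)` and then
`V(u′, w)` principalize `K = (f̂, u²)`»; plan-1 g6 KERNEL NOTE v1.6 «depth-ONE escaped sub-problems on the
weight-1 carriers»):

* §1 `controlledTransform_sup_controlledTransform_eq_top` — blowing up `C = A + B` SEPARATES the weight-one
  transforms: `(σ^*A : 𝓖) + (σ^*B : 𝓖) = 𝒪` (cancel the effective Cartier `𝓖 = σ^*C` in `𝓖 = 𝓖 · (… + …)`);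
* §2 `controlledTransform_eq_sup_exceptional` — for the ORDER-ONE RESIDUAL SHAPE `K = H + 𝓘_E²`, after blowing
  up `C₁ = H + 𝓘_E` with weight one: `K₁ := (σ^*K : 𝓖) = H₁ + 𝓖` (`H₁ = (σ^*H : 𝓖)`), in particular
  `𝓖 ⊆ K₁` (`exceptional_le_controlledTransform`) — the DEPTH-ONE format with respect to the new exceptional
  divisor (chart check `K = (h, t²)`: `t = h t′` gives `(h)`, `h = t h′` gives `t · (h′, t)`);
* §3 `isRegular_subscheme_controlledTransform_sup_exceptional` — for `X` regular locally Noetherian, `V(C)`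
  regular and `H ⊆ C` with `𝒪_{X,x}/H_x` regular at the points of `V(C)` (the host is regular ALONG the
  centre; nothing is asked away from it), the scheme `V((σ^*H : 𝓖) + 𝓖)` — strict transform of the host ∩
  exceptional divisor — is REGULAR: at a point `y`, an adapted regular system of parameters `(c, w)` of
  `𝒪_{X,σy}` (nested Matsumura 14.2, `exists_isRsopPart_nested_span_range_eq`), the Rees chart
  `𝒪_{X₁,y} = (𝒪_{X,σy}[(c)/c_i])_𝔴` (`IsBlowup.exists_reesChart_stalk`), `𝓖_y = (c_i)`, `H₁_y = (e_j : j ∈ T)`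
  (`IsBlowup.stalkIdeal_controlledTransform_eq_span_chartGen`), and `(c_i, e_T, w)` is part of a regular system
  of parameters of `𝒪_{X₁,y}` (`isRsopPart_chartFamily_reesChart`), so `𝒪_{X₁,y}/(c_i, e_T)` is regular.

AI-written; AI review is weaker than expert review.

## References

* U. Görtz, T. Wedhorn, *Algebraic Geometry I*, 2nd ed. (2020), Prop. 13.91 (1), Prop. 13.96 (2), p. 416.
  [GortzWedhorn2020]
* E. Bierstone, D. Grigoriev, P. Milman, J. Włodarczyk, *Effective Hironaka resolution and its complexity*
  (2011), §3.2 Lemma 3.2.1. [BierstoneGrigorievMilmanWlodarczyk2011]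
* H. Matsumura, *Commutative Ring Theory* (1986), Thm. 14.2. [Matsumura1987]
* The Stacks Project, Tags 0804, 0BIQ. [StacksProject]
-/

-- `Summit.<Summit>.<Sub>.Theorems` with `Sub = Summit` (single-conjunct summit, D-0017)
set_option linter.dupNamespace false

noncomputable section

open CategoryTheory CategoryTheory.Limits AlgebraicGeometry TopologicalSpace
open Literature.AlgebraicGeometry.Resolution
open IsLocalRing

namespace Summit.ResolutionOfSingularities.ResolutionOfSingularities.Theorems

universe u

namespace DepthTwo

/-! ## §1 Blowing up `A + B` separates the weight-one transforms of `A` and `B` -/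

/-- **Blowing up `C = A + B` separates the weight-one controlled transforms of `A` and `B`**:
`(σ^*A : 𝓘_{exc}) + (σ^*B : 𝓘_{exc}) = 𝒪` — cancel the effective Cartier divisor `𝓘_{exc} = σ^*C` in
`𝓘_{exc} · 𝒪 = σ^*A + σ^*B = 𝓘_{exc} · ((σ^*A : 𝓘_{exc}) + (σ^*B : 𝓘_{exc}))`. [folklore] -/
theorem controlledTransform_sup_controlledTransform_eq_top {X X' : Scheme.{u}} {σ : X' ⟶ X}
    {A B C : X.IdealSheafData} (hσ : IsBlowup σ C) (hA : A ≤ C) (hB : B ≤ C) (hC : C ≤ A ⊔ B) :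
    controlledTransform σ C A 1 ⊔ controlledTransform σ C B 1 = ⊤ := by
  have hG : IsEffectiveCartier (C.comap σ) := hσ.isEffectiveCartier
  refine (hG.eq_of_mul_eq_mul ?_).symm
  rw [Scheme.IdealSheafData.mul_top, Scheme.IdealSheafData.mul_inf,
    hσ.comap_mul_controlledTransform_one hA, hσ.comap_mul_controlledTransform_one hB,
    ← (Scheme.IdealSheafData.map_gc σ).l_sup]
  exact le_antisymm (Scheme.IdealSheafData.comap_mono σ hC)
    (Scheme.IdealSheafData.comap_mono σ (sup_le hA hB))

/-! ## §2 The first blow-up of the end-game: `K = H + 𝓘_E²` along `C₁ = H + 𝓘_E` -/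

/-- If `I + J = 𝒪` then `I + J² = 𝒪` (sections: `(I + J)³ ⊆ I + J²`). [folklore] -/
theorem sup_sq_eq_top_of_sup_eq_top {X : Scheme.{u}} {I J : X.IdealSheafData} (h : I ⊔ J = ⊤) :
    I ⊔ J ^ 2 = ⊤ := by
  refine le_antisymm le_top (Scheme.IdealSheafData.le_def.mpr fun U => ?_)
  have hU : I.ideal U ⊔ J.ideal U = ⊤ := by
    have := congrArg (fun L : X.IdealSheafData => L.ideal U) h
    simpa only [Scheme.IdealSheafData.ideal_sup, Pi.sup_apply, Scheme.IdealSheafData.ideal_top,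
      Pi.top_apply] using this
  rw [Scheme.IdealSheafData.ideal_sup, Pi.sup_apply, Scheme.IdealSheafData.ideal_pow, Pi.pow_apply,
    Scheme.IdealSheafData.ideal_top, Pi.top_apply]
  calc (⊤ : Ideal Γ(X, U)) = (I.ideal U ⊔ J.ideal U) ^ (1 + 2) := by rw [hU, Ideal.top_pow]
    _ ≤ I.ideal U ^ 1 ⊔ J.ideal U ^ 2 := Ideal.sup_pow_add_le_pow_sup_pow
    _ = I.ideal U ⊔ J.ideal U ^ 2 := by rw [pow_one]

/-- `I · J ⊆ J` for ideal sheaves. [folklore] -/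
theorem mul_le_left' {X : Scheme.{u}} (I J : X.IdealSheafData) : I * J ≤ J :=
  Scheme.IdealSheafData.le_def.mpr fun U => by
    rw [Scheme.IdealSheafData.ideal_mul, Pi.mul_apply]
    exact Ideal.mul_le_left

/-- `I · J ⊆ I` for ideal sheaves. [folklore] -/
theorem mul_le_right' {X : Scheme.{u}} (I J : X.IdealSheafData) : I * J ≤ I :=
  Scheme.IdealSheafData.le_def.mpr fun U => by
    rw [Scheme.IdealSheafData.ideal_mul, Pi.mul_apply]
    exact Ideal.mul_le_right

/-- `I² ⊆ I` for ideal sheaves. [folklore] -/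
theorem sq_le_self' {X : Scheme.{u}} (I : X.IdealSheafData) : I ^ 2 ≤ I := by
  rw [sq]; exact mul_le_left' I I

/-- **Format after blowing up `C₁ = H + 𝓘_E` (weight one)**: with `𝓖 = σ^*C₁` the exceptional ideal,
`H₁ = (σ^*H : 𝓖)` and `𝓔₁ = (σ^*𝓘_E : 𝓖)` the weight-one transforms (strict transforms of the host and
of `E`), the weight-one transform of `K = H + 𝓘_E²` is `K₁ = (σ^*K : 𝓖) = H₁ + 𝓖` — because
`H₁ + 𝓔₁ = 𝒪` (the strict transforms SEPARATE) gives `𝓖² ⊆ 𝓖 H₁ + 𝓖² 𝓔₁²`, so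
`𝓖 · (H₁ + 𝓖) = σ^*H + σ^*𝓘_E² = σ^*K = 𝓖 · K₁`. In particular `𝓖 ⊆ K₁`: the DEPTH-ONE format
with respect to the new exceptional divisor. Chart check: `K = (h, t²)`, `t = h t'` gives `(h)`,
`h = t h'` gives `t · (h', t)`. [folklore] -/
theorem controlledTransform_eq_sup_exceptional {X X' : Scheme.{u}} {σ : X' ⟶ X}
    {H Ei K : X.IdealSheafData} (hK : K = H ⊔ Ei ^ 2) (hσ : IsBlowup σ (H ⊔ Ei)) :
    controlledTransform σ (H ⊔ Ei) K 1 =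
      controlledTransform σ (H ⊔ Ei) H 1 ⊔ (H ⊔ Ei).comap σ := by
  set C := H ⊔ Ei with hCdef
  set G := C.comap σ with hGdef
  have hG : IsEffectiveCartier G := hσ.isEffectiveCartier
  have hHC : H ≤ C := le_sup_left
  have hEC : Ei ≤ C := le_sup_right
  have hKC : K ≤ C := by
    rw [hK]
    exact sup_le le_sup_left ((sq_le_self' Ei).trans le_sup_right)
  set H₁ := controlledTransform σ C H 1
  set E₁ := controlledTransform σ C Ei 1
  have hsep : H₁ ⊔ E₁ = ⊤ := controlledTransform_sup_controlledTransform_eq_top hσ hHC hEC le_rfl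
  have hsep2 : H₁ ⊔ E₁ ^ 2 = ⊤ := sup_sq_eq_top_of_sup_eq_top hsep
  have hGH : G * H₁ = H.comap σ := hσ.comap_mul_controlledTransform_one hHC
  have hGE : G * E₁ = Ei.comap σ := hσ.comap_mul_controlledTransform_one hEC
  have hGK : G * controlledTransform σ C K 1 = K.comap σ := hσ.comap_mul_controlledTransform_one hKC
  apply hG.eq_of_mul_eq_mul
  rw [hGK, hK, (Scheme.IdealSheafData.map_gc σ).l_sup, comap_pow, ← hGH, ← hGE,
    Scheme.IdealSheafData.mul_inf]
  apply le_antisymm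
  · -- `(𝓖 𝓔₁)² ⊆ 𝓖²`
    refine sup_le le_sup_left (le_sup_right.trans' ?_)
    calc (G * E₁) ^ 2 = G * G * (E₁ * E₁) := by rw [sq]; ring
      _ ≤ G * G := mul_le_right' _ _
  · -- `𝓖² = 𝓖² (H₁ + 𝓔₁²) ⊆ 𝓖 H₁ + (𝓖 𝓔₁)²`
    refine sup_le le_sup_left ?_
    calc G * G = G * G * (H₁ ⊔ E₁ ^ 2) := by rw [hsep2, Scheme.IdealSheafData.mul_top]
      _ = G * (G * H₁) ⊔ (G * E₁) ^ 2 := by rw [Scheme.IdealSheafData.mul_inf]; ring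
      _ ≤ G * H₁ ⊔ (G * E₁) ^ 2 := sup_le_sup_right (mul_le_left' _ _) _

/-- In the situation of `controlledTransform_eq_sup_exceptional`, the exceptional ideal lies in the
weight-one transform of `K`: `𝓖 ⊆ K₁`. [folklore] -/
theorem exceptional_le_controlledTransform {X X' : Scheme.{u}} {σ : X' ⟶ X}
    {H Ei K : X.IdealSheafData} (hK : K = H ⊔ Ei ^ 2) (hσ : IsBlowup σ (H ⊔ Ei)) :
    (H ⊔ Ei).comap σ ≤ controlledTransform σ (H ⊔ Ei) K 1 := by
  rw [controlledTransform_eq_sup_exceptional hK hσ]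
  exact le_sup_right

/-! ## §3 The strict transform of a regular subscheme meets the exceptional divisor regularly -/

/-- **The weight-one (strict) transform `H′ = (σ^*H : 𝓖)` of a closed subscheme `V(H) ⊇ V(C)` which is
REGULAR ALONG THE CENTRE meets the exceptional divisor `V(𝓖)` of the blowing up `σ` of the regular
locally Noetherian `X` along the regular centre `V(C)` in a REGULAR scheme `V(H′ + 𝓖)`.** At a point `y`
of `V(H′ + 𝓖)`, choose a regular system of parameters `(c, w)` of `𝒪_{X,σy}` adapted to the nested regular
pair `H_{σy} = (c_j : j ∈ T) ⊆ C_{σy} = (c)` (nested Matsumura 14.2); in the Rees chart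
`𝒪_{X',y} = (𝒪_{X,σy}[(c)/c_i])_𝔴` one has `𝓖_y = (c_i)`, `H′_y = (e_j : j ∈ T)` (`c_j = c_i e_j`), and
`(c_i, e_T, w)` is part of a regular system of parameters of `𝒪_{X',y}`; so `𝒪_{X',y}/(c_i, e_T)` is a
regular local ring. (For a hypersurface `H = (h)`: `V(h/t, t) ≅ V(h, t)` chart by chart.)
[cite: GortzWedhorn2020, Prop. 13.96 (2) and p. 416] [cite: Matsumura1987, Thm. 14.2] [cite: StacksProject, Tag 0BIQ] -/
theorem isRegular_subscheme_controlledTransform_sup_exceptional {X X' : Scheme.{u}}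
    [IsLocallyNoetherian X] {σ : X' ⟶ X} {C H : X.IdealSheafData} (hX : Scheme.IsRegular X)
    (hσ : IsBlowup σ C) (hC : Scheme.IsRegular C.subscheme) (hHC : H ≤ C)
    (hH : ∀ x ∈ C.support, IsRegularLocalRing (X.presheaf.stalk x ⧸ stalkIdeal H x)) :
    Scheme.IsRegular (controlledTransform σ C H 1 ⊔ C.comap σ).subscheme := by
  classical
  haveI : IsProper σ := hσ.isProper
  haveI : IsLocallyNoetherian X' := LocallyOfFiniteType.isLocallyNoetherian σ
  refine Scheme.isRegular_subscheme_of_forall _ fun y hy => ?_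
  -- `y` lies on `V(H′)` and on the exceptional divisor, so `σ y` lies on the centre
  have hyH : y ∈ (controlledTransform σ C H 1).support :=
    Scheme.IdealSheafData.support_antitone le_sup_left hy
  have hyG : y ∈ (C.comap σ).support := Scheme.IdealSheafData.support_antitone le_sup_right hy
  have hyC : σ y ∈ C.support := by
    have h := hyG
    rw [Scheme.IdealSheafData.support_comap] at h
    exact h
  -- an adapted regular system of parameters `(f, w)` of `𝒪_{X,σy}`: `C = (f)`, `H = (f ∘ castAdd b)`
  haveI : IsRegularLocalRing (X.presheaf.stalk (σ y)) := hX _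
  haveI := isRegularLocalRing_stalk_quotient_stalkIdeal hC hyC
  haveI := hH (σ y) hyC
  obtain ⟨a, b, f, hf, hfC, hfH⟩ := exists_isRsopPart_nested_span_range_eq (stalkIdeal_mono hHC (σ y))
    ((mem_support_iff_stalkIdeal_le C (σ y)).mp hyC)
  obtain ⟨e, x, hd, hx, hxf⟩ := hf.exists_rsop
  let w : Fin e → X.presheaf.stalk (σ y) := fun k => x (Fin.natAdd (a + b) k)
  have happ : Fin.append f w = x := by
    funext m
    induction m using Fin.addCases with
    | left j => rw [Fin.append_left, hxf]
    | right k => rw [Fin.append_right]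
  have hz : Ideal.span (Set.range (Fin.append f w)) = maximalIdeal (X.presheaf.stalk (σ y)) := by
    rw [happ]; exact hx
  set T : Set (Fin (a + b)) := Set.range (Fin.castAdd b) with hTdef
  have hTH : Ideal.span (f '' T) = stalkIdeal H (σ y) := by
    rw [hTdef, ← Set.range_comp]; exact hfH
  -- the Rees chart at `y`
  obtain ⟨i, 𝔴, χ, hχ, hloc, h𝔴⟩ := hσ.exists_reesChart_stalk y f hfC
  obtain ⟨hE, hH'⟩ := hσ.stalkIdeal_controlledTransform_eq_span_chartGen y f hfC T hTH i 𝔴 χ hχ hloc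
  letI alg : Algebra (chartRing f i) (X'.presheaf.stalk y) := χ.toAlgebra
  haveI : IsLocalization.AtPrime (X'.presheaf.stalk y) 𝔴.asIdeal := hloc
  haveI : 𝔴.asIdeal.IsPrime := 𝔴.isPrime
  have halg : ∀ r, algebraMap (chartRing f i) (X'.presheaf.stalk y) r = χ r := fun r => by
    rw [RingHom.algebraMap_toAlgebra]
  -- `y ∈ V(H′)`: every `e_j`, `j ∈ T`, lies in `𝔴`, and `i ∉ T`
  have hNtop : Ideal.span ((fun j => χ (chartGen f i j)) '' T) ≠ ⊤ := fun h =>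
    (maximalIdeal.isMaximal (X'.presheaf.stalk y)).ne_top
      (top_le_iff.mp (h ▸ hH' ▸ (mem_support_iff_stalkIdeal_le _ y).mp hyH))
  have hNle := IsLocalRing.le_maximalIdeal hNtop
  have hmem𝔴 : ∀ j ∈ T, chartGen f i j ∈ 𝔴.asIdeal := by
    intro j hj
    have h2 := hNle (Ideal.subset_span (Set.mem_image_of_mem (fun j => χ (chartGen f i j)) hj))
    rw [← halg] at h2
    exact (IsLocalization.AtPrime.to_map_mem_maximal_iff (X'.presheaf.stalk y) 𝔴.asIdeal _).mp h2
  have hii : chartGen f i i = 1 := chartGen_self f i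
  have hiT : i ∉ T := fun hi => by
    have h1 := hmem𝔴 i hi
    rw [hii] at h1
    exact 𝔴.isPrime.ne_top ((Ideal.eq_top_iff_one _).mpr h1)
  -- enumerate `T` by `Fin a` and get the part `(c_i, e_T, w)` of a regular system of parameters of `𝒪_{X',y}`
  let jJ : Fin a → {j : Fin (a + b) // j ≠ i} := fun k =>
    ⟨Fin.castAdd b k, fun h => hiT (h ▸ Set.mem_range_self k)⟩
  have hjJ : Function.Injective jJ := fun k₁ k₂ h =>
    Fin.castAdd_injective _ _ (congrArg Subtype.val h)
  have hJ : ∀ k, chartGen f i (jJ k).1 ∈ 𝔴.asIdeal := fun k => hmem𝔴 _ (Set.mem_range_self k)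
  have hrsop := isRsopPart_chartFamily_reesChart f i w hz hd 𝔴.asIdeal h𝔴 (X'.presheaf.stalk y) jJ hjJ hJ
  -- the sub-family `(c_i, e_T)`
  let ι : Fin (a + 1) → Fin (a + e + 1) := Fin.cons 0 fun k => (Fin.castAdd e k).succ
  have hι : Function.Injective ι := by
    refine Fin.cons_injective_iff.mpr ⟨?_, fun k₁ k₂ h => Fin.castAdd_injective _ _ (Fin.succ_injective _ h)⟩
    rintro ⟨k, hk⟩
    exact Fin.succ_ne_zero _ hk
  have hsub := hrsop.comp ι hι
  have hfam : chartFamily f i w (X'.presheaf.stalk y) (chartBase f i) (chartGen f i) jJ ∘ ι =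
      Fin.cons (χ (chartBase f i (f i))) (fun k => χ (chartGen f i (jJ k).1)) := by
    funext m
    refine Fin.cases ?_ (fun k => ?_) m
    · simp only [Function.comp_apply, ι, Fin.cons_zero, chartFamily, halg]
    · simp only [Function.comp_apply, ι, Fin.cons_succ, chartFamily, Fin.append_left, halg]
  have hrange : Set.range (chartFamily f i w (X'.presheaf.stalk y) (chartBase f i) (chartGen f i) jJ ∘ ι) =
      insert (χ (chartBase f i (f i))) ((fun j => χ (chartGen f i j)) '' T) := by
    rw [hfam, Fin.range_cons]
    congr 1
    ext z
    constructor
    · rintro ⟨k, rfl⟩; exact ⟨(jJ k).1, Set.mem_range_self k, rfl⟩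
    · rintro ⟨_, ⟨k, rfl⟩, rfl⟩; exact ⟨k, rfl⟩
  have hideal : stalkIdeal (controlledTransform σ C H 1 ⊔ C.comap σ) y =
      Ideal.span (Set.range (chartFamily f i w (X'.presheaf.stalk y) (chartBase f i) (chartGen f i) jJ ∘ ι)) := by
    rw [stalkIdeal_sup, hH', hE, hrange, Ideal.span_insert, sup_comm]
  rw [hideal]
  exact hsub.isRegularLocalRing_quotient

end DepthTwo

end Summit.ResolutionOfSingularities.ResolutionOfSingularities.Theorems

end
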